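import Mathlib.Algebra.MvPolynomial.Monad
import Mathlib.Algebra.MvPolynomial.CommRing
import Mathlib.Algebra.MvPolynomial.Degrees
import Mathlib.Analysis.Real.Sqrt
import Mathlib.Tactic.Linarith
import HarnessLib

/-!
# Pseudo-bounded polynomials of order `T` (the SOS sandwich class `K_T`)

Topic `Literature/Computability/QuantumComplexity`; definition request `defn-PseudoBounded` of
route `QuantumAdvantage/SosSandwich` (idea card `pseudo-bounded-influence`).

A real polynomial `p` in `N` variables is **pseudo-bounded of order `T`** (`PseudoBounded T p`)
when BOTH `p` and `1 - p` are, as functions on the Boolean cube `{0,1}^N`, sums of squares of real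
polynomials of total degree `≤ T`:
`p(x) = Σ_j q_j(x)²` and `1 - p(x) = Σ_j r_j(x)²` for all `x ∈ {0,1}^N`, `deg q_j, deg r_j ≤ T`.
In the terminology of J. Kaniewski, T. Lee, R. de Wolf, *Query complexity in expectation*
(ICALP 2015; arXiv:1411.7280), Definition 7, a "sum-of-squares polynomial of degree `d`" is
`Σ_{i ∈ 𝒫} p_i(x)²` with `𝒫` finite and `deg p_i ≤ d`, and the *sos degree* `deg_sos(f)` of
`f : {0,1}^n → ℝ₊` is the least `d` for which such a polynomial equals `f` on `{0,1}^n`; so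
`PseudoBounded T p ↔ deg_sos(p|_{cube}) ≤ T ∧ deg_sos((1 - p)|_{cube}) ≤ T`, and by their
Theorem 12 (`QE(f) = deg_sos(f)`: quantum query complexity in expectation equals sos degree)
this is the class `K_T = {QE(p) ≤ T ∧ QE(1 - p) ≤ T}` of the route thesis. The NAME
"pseudo-bounded" is the route's (hub idea card `pseudo-bounded-influence`), not the paper's: such a
`p` takes values in `[0,1]` on the cube (`PseudoBounded.bounded`) and, dually, `0 ≤ Ẽ[p] ≤ 1` for
every normalised degree-`2T` pseudo-expectation (route item `PseudoBoundedDual`, not proved here).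

## Design: a FACT-FREE module (route SosSandwich rev 1, "cone repair")

This file imports Mathlib (and the tag library `HarnessLib`) ONLY. The rev-0 request said "next to
`AAConjecture` in `AaronsonAmbainis.lean`", but that module is the home of the two registered open
conjectures `AAConjecture` / `QuantumQuerySimulable`, and a by-name use of the notion would drag
them into the route's module cone; rev 1 of the route therefore asks for
`Literature/Computability/QuantumComplexity/PseudoBounded.lean` importing Mathlib only, with the
Boolean evaluation written out as `MvPolynomial.eval (fun k => if x k then (1 : ℝ) else 0) p`.
That term is, by `rfl`, both the tree's `Literature.Computability.QuantumComplexity.evalBool p x`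
(`AaronsonAmbainis.lean`; to move verbatim to `BooleanInfluence.lean` with item
defn-BooleanInfluence) and the route items' local `ev p x`
(`let ev := fun f x => MvPolynomial.eval (fun k => if x k then (1 : ℝ) else 0) f`), so
`PseudoBounded T p` is definitionally (`Iff.rfl`) the hypothesis inlined in route items
`PseudoBoundedAA`, `OneQueryFrameAA`, `HomogeneousPBAA`, `PseudoBoundedRestrict`,
`PseudoBoundedDual`, `AAConjImpliesPBAA`, and `QueryAcceptPseudoBounded Q` reads
`PseudoBounded Q.queries (acceptance polynomial)`. Once the vocabulary hoist lands, an
imports-only edit may restate everything by name; nothing here changes.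

## Contents (everything PROVED; no named facts)

* `PseudoBounded T p` — the definition (`pseudoBounded_iff` is `Iff.rfl`), with one common index
  type `Fin m` for the two families (pad with zero polynomials to equalise).
* bookkeeping: values in `[0,1]` on the cube (`eval_nonneg`, `eval_le_one`, `bounded` — the
  boundedness hypothesis of `AAConjecture`, in its exact shape), monotonicity in `T` (`mono`), the
  symmetry `p ↔ 1 - p` (`one_sub`, `pseudoBounded_one_sub_iff`), dependence on cube values only
  (`of_eval_eq`), non-vacuity (`pseudoBounded_C` for constants in `[0,1]` at every order,
  `pseudoBounded_X` for a variable at order `≥ 1`) and non-triviality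
  (`not_pseudoBounded_C_two`).
* `PseudoBounded.restrict` — closure under the Boolean restriction `xᵢ := b` rendered as
  `MvPolynomial.bind₁ (fun j => if j = i then C b else X j)` (the variable kept as a dummy), the
  exact form of route item `PseudoBoundedRestrict`: substitute into the `q_j, r_j`; on the cube
  the restricted polynomials evaluate at the updated point (`eval_cube_bind₁_restrictVar`), and an
  affine substitution does not raise total degrees. (This `bind₁` is definitionally the
  `restrictPoly i b p` of `AaronsonAmbainisProofs.lean`, `bind₁ = aeval`.)

## Deliberately NOT here (route items for provers, or separate facts)

`Q_T ⊆ K_T` (acceptance probabilities of `T`-query algorithms are pseudo-bounded of order `T`: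
Beals et al. amplitude polynomials + unitarity = the `≥` half of KLdW Thm. 12; route item
`QueryAcceptPseudoBounded`), the conic-duality characterisation (`PseudoBoundedDual`), the
multilinear representative of degree `≤ 2T` (`AAConjImpliesPBAA`), and any influence inequality
(`PseudoBoundedAA`, `OneQueryFrameAA`, `HomogeneousPBAA` are conjectures/targets of the route, not
literature).

## References

* J. Kaniewski, T. Lee, R. de Wolf, *Query complexity in expectation*, ICALP 2015, LNCS 9134,
  761–772; arXiv:1411.7280 — Def. 7 (sos degree), Thm. 12 (`QE(f) = deg_sos(f)`). Numbering
  follows the arXiv version. [KaniewskiLeeDewolf2015]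
* S. Aaronson, A. Ambainis, *The need for structure in quantum speedups*, Theory Comput. 10 (2014)
  133–166, §3 (restrictions `p|_{xᵢ := b}` in the proof of Thm. 3.3). [AaronsonAmbainis2014]
-/

noncomputable section

open Finset MvPolynomial

namespace Literature.Computability.QuantumComplexity

variable {N : ℕ}

/-! ### Two Mathlib-level lemmas: restriction on the cube, degree of an affine substitution -/

/-- On the cube, the restriction `p|_{xᵢ := b}` — substitute the constant `b ∈ {0,1}` for `Xᵢ`,
keeping `Xᵢ` as a dummy variable — evaluates as `p` at the point with its `i`-th bit set to `b`.
[cite: AaronsonAmbainis2014, Thm. 3.3 (proof: the restriction p_{j+1} of p_j to x_i := answer)] -/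
theorem eval_cube_bind₁_restrictVar (i : Fin N) (b : Bool) (p : MvPolynomial (Fin N) ℝ)
    (x : Fin N → Bool) :
    MvPolynomial.eval (fun k => if x k then (1 : ℝ) else 0)
        (bind₁ (fun j => if j = i then C (if b then (1 : ℝ) else 0) else X j) p) =
      MvPolynomial.eval (fun k => if Function.update x i b k then (1 : ℝ) else 0) p := by
  induction p using MvPolynomial.induction_on with
  | C a => simp
  | add p q hp hq => simp only [map_add, hp, hq]
  | mul_X p j hp =>
    simp only [map_mul, hp, bind₁_X_right, eval_X]
    congr 1
    by_cases hj : j = i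
    · subst hj
      cases b <;> simp
    · simp [hj]

/-- Substituting polynomials of total degree `≤ 1` does not raise the total degree. (Private copy
of a folklore lemma the tree proves in several heavier files, e.g.
`totalDegree_bind₁_le_of_le_one` of `BlockSensitivityQuantumBound.lean`; kept private so that this
definition file imports Mathlib only.) [folklore] -/
private theorem totalDegree_bind₁_le_of_forall_le_one {σ τ R : Type*} [CommSemiring R]
    (φ : σ → MvPolynomial τ R) (hφ : ∀ i, (φ i).totalDegree ≤ 1) (F : MvPolynomial σ R) :
    (bind₁ φ F).totalDegree ≤ F.totalDegree := by
  classical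
  conv_lhs => rw [F.as_sum]
  rw [map_sum]
  refine (totalDegree_finsetSum _ _).trans (Finset.sup_le fun e he => ?_)
  rw [bind₁_monomial]
  refine (totalDegree_mul _ _).trans ?_
  rw [totalDegree_C, zero_add]
  refine (totalDegree_finsetProd _ _).trans ?_
  refine le_trans (Finset.sum_le_sum fun i _ => (totalDegree_pow _ _).trans
    (Nat.mul_le_mul_left _ (hφ i))) ?_
  simp only [mul_one]
  exact le_totalDegree he

/-! ### The definition -/

/-- **Pseudo-bounded of order `T`** (the SOS sandwich class `K_T` of route
`QuantumAdvantage/SosSandwich`): the real polynomial `p` in `N` variables and its complement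
`1 - p` are both, AS FUNCTIONS ON THE BOOLEAN CUBE `{0,1}^N` (a point `x : Fin N → Bool` is read
as the `0/1`-vector `fun k => if x k then 1 else 0`), sums of squares of real polynomials of total
degree `≤ T` — there are `m` and polynomials `q_0,…,q_{m-1}`, `r_0,…,r_{m-1}` with `deg q_j ≤ T`,
`deg r_j ≤ T`, and for every `x ∈ {0,1}^N`, `p(x) = Σ_j q_j(x)²` and `1 - p(x) = Σ_j r_j(x)²`.
In the language of Kaniewski–Lee–de Wolf (Definition 7: a "sum-of-squares polynomial of degree
`d`" is `Σ_i p_i²` with `deg p_i ≤ d`; `deg_sos(f)` = least such `d` representing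
`f : {0,1}^n → ℝ₊` on the cube) this says `deg_sos(p) ≤ T` and `deg_sos(1 - p) ≤ T`; by their
Theorem 12 (`QE(f) = deg_sos(f)`, quantum query complexity in expectation) it is the class
`{QE(p) ≤ T ∧ QE(1-p) ≤ T}`, which contains the acceptance probability of every `T`-query quantum
algorithm (Beals et al.: amplitudes are degree-`≤ T` polynomials, plus unitarity). One common
index set `Fin m` serves both families (pad with zeros). The name "pseudo-bounded" is the route's,
after the dual description `0 ≤ Ẽ[p] ≤ 1` for all degree-`2T` pseudo-expectations; such `p` is in
particular `[0,1]`-valued on the cube (`PseudoBounded.bounded`). The evaluation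
`MvPolynomial.eval (fun k => if x k then (1 : ℝ) else 0) p` is by `rfl` the tree's `evalBool p x`
and the route items' `ev p x`, so this is definitionally the formula inlined in the items of
`SosSandwich` (`pseudoBounded_iff`).
[cite: KaniewskiLeeDewolf2015, Def. 7 and Thm. 12 (arXiv:1411.7280 numbering)] -/
def PseudoBounded (T : ℕ) (p : MvPolynomial (Fin N) ℝ) : Prop :=
  ∃ (m : ℕ) (q r : Fin m → MvPolynomial (Fin N) ℝ),
    (∀ j, (q j).totalDegree ≤ T ∧ (r j).totalDegree ≤ T) ∧
    ∀ x : Fin N → Bool,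
      MvPolynomial.eval (fun k => if x k then (1 : ℝ) else 0) p =
          ∑ j, MvPolynomial.eval (fun k => if x k then (1 : ℝ) else 0) (q j) ^ 2 ∧
        1 - MvPolynomial.eval (fun k => if x k then (1 : ℝ) else 0) p =
          ∑ j, MvPolynomial.eval (fun k => if x k then (1 : ℝ) else 0) (r j) ^ 2

/-- Unfolding lemma: `PseudoBounded T p` is, by `Iff.rfl`, the formula inlined in the route items
of `SosSandwich`. [folklore] -/
theorem pseudoBounded_iff (T : ℕ) (p : MvPolynomial (Fin N) ℝ) :
    PseudoBounded T p ↔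
      ∃ (m : ℕ) (q r : Fin m → MvPolynomial (Fin N) ℝ),
        (∀ j, (q j).totalDegree ≤ T ∧ (r j).totalDegree ≤ T) ∧
        ∀ x : Fin N → Bool,
          MvPolynomial.eval (fun k => if x k then (1 : ℝ) else 0) p =
              ∑ j, MvPolynomial.eval (fun k => if x k then (1 : ℝ) else 0) (q j) ^ 2 ∧
            1 - MvPolynomial.eval (fun k => if x k then (1 : ℝ) else 0) p =
              ∑ j, MvPolynomial.eval (fun k => if x k then (1 : ℝ) else 0) (r j) ^ 2 :=
  Iff.rfl

namespace PseudoBounded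

variable {T : ℕ} {p : MvPolynomial (Fin N) ℝ}

/-- A pseudo-bounded polynomial is nonnegative on the cube (`p = Σ q_j²` there). [folklore] -/
theorem eval_nonneg (h : PseudoBounded T p) (x : Fin N → Bool) :
    0 ≤ MvPolynomial.eval (fun k => if x k then (1 : ℝ) else 0) p := by
  obtain ⟨m, q, r, -, hval⟩ := h
  rw [(hval x).1]
  exact Finset.sum_nonneg fun j _ => sq_nonneg _

/-- A pseudo-bounded polynomial is at most `1` on the cube (`1 - p = Σ r_j²` there). [folklore] -/
theorem eval_le_one (h : PseudoBounded T p) (x : Fin N → Bool) :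
    MvPolynomial.eval (fun k => if x k then (1 : ℝ) else 0) p ≤ 1 := by
  obtain ⟨m, q, r, -, hval⟩ := h
  have h0 : 0 ≤ 1 - MvPolynomial.eval (fun k => if x k then (1 : ℝ) else 0) p := by
    rw [(hval x).2]
    exact Finset.sum_nonneg fun j _ => sq_nonneg _
  linarith

/-- Pseudo-bounded polynomials are bounded: `0 ≤ p(x) ≤ 1` on `{0,1}^N` — the boundedness
hypothesis of `AAConjecture` (`∀ x, 0 ≤ evalBool p x ∧ evalBool p x ≤ 1`), in its exact shape.
[folklore] -/
theorem bounded (h : PseudoBounded T p) :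
    ∀ x : Fin N → Bool, 0 ≤ MvPolynomial.eval (fun k => if x k then (1 : ℝ) else 0) p ∧
      MvPolynomial.eval (fun k => if x k then (1 : ℝ) else 0) p ≤ 1 :=
  fun x => ⟨h.eval_nonneg x, h.eval_le_one x⟩

/-- Monotonicity in the order: `K_T ⊆ K_{T'}` for `T ≤ T'`. [folklore] -/
theorem mono {T' : ℕ} (hT : T ≤ T') (h : PseudoBounded T p) : PseudoBounded T' p := by
  obtain ⟨m, q, r, hdeg, hval⟩ := h
  exact ⟨m, q, r, fun j => ⟨(hdeg j).1.trans hT, (hdeg j).2.trans hT⟩, hval⟩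

/-- The class is symmetric under `p ↦ 1 - p` (swap the two SOS certificates). [folklore] -/
theorem one_sub (h : PseudoBounded T p) : PseudoBounded T (1 - p) := by
  obtain ⟨m, q, r, hdeg, hval⟩ := h
  refine ⟨m, r, q, fun j => ⟨(hdeg j).2, (hdeg j).1⟩, fun x => ?_⟩
  obtain ⟨h1, h2⟩ := hval x
  refine ⟨?_, ?_⟩
  · rw [map_sub, map_one]
    exact h2
  · rw [map_sub, map_one, sub_sub_cancel]
    exact h1

/-- Pseudo-boundedness depends only on the values of `p` on the cube: any polynomial agreeing
with `p` on `{0,1}^N` (e.g. its multilinear representative) is pseudo-bounded of the same order,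
with the same certificates. [folklore] -/
theorem of_eval_eq {p' : MvPolynomial (Fin N) ℝ} (h : PseudoBounded T p)
    (hp' : ∀ x : Fin N → Bool, MvPolynomial.eval (fun k => if x k then (1 : ℝ) else 0) p' =
      MvPolynomial.eval (fun k => if x k then (1 : ℝ) else 0) p) :
    PseudoBounded T p' := by
  obtain ⟨m, q, r, hdeg, hval⟩ := h
  exact ⟨m, q, r, hdeg, fun x => by rw [hp']; exact hval x⟩

/-- **`K_T` is closed under restriction** (route item `PseudoBoundedRestrict` of `SosSandwich`,
in its exact form): substituting a Boolean constant `b` for the variable `Xᵢ`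
(`MvPolynomial.bind₁`, the variable kept as a dummy) preserves pseudo-boundedness of order `T` —
substitute into the `q_j, r_j`: on the cube the restricted polynomials evaluate at the updated
point (`eval_cube_bind₁_restrictVar`), and an affine substitution does not raise total degrees.
[folklore] -/
theorem restrict (h : PseudoBounded T p) (i : Fin N) (b : Bool) :
    PseudoBounded T
      (MvPolynomial.bind₁
        (fun j => if j = i then MvPolynomial.C (if b then (1 : ℝ) else 0) else MvPolynomial.X j)
        p) := by
  obtain ⟨m, q, r, hdeg, hval⟩ := h
  have hφ : ∀ j : Fin N,
      ((fun j => if j = i then C (if b then (1 : ℝ) else 0) else X j) j :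
        MvPolynomial (Fin N) ℝ).totalDegree ≤ 1 := by
    intro j
    by_cases hj : j = i
    · simp only [hj, if_true, totalDegree_C]
      exact Nat.zero_le _
    · simp only [hj, if_false]
      rw [totalDegree_X]
  refine ⟨m, fun k => bind₁ (fun j => if j = i then C (if b then (1 : ℝ) else 0) else X j) (q k),
    fun k => bind₁ (fun j => if j = i then C (if b then (1 : ℝ) else 0) else X j) (r k),
    fun k => ⟨?_, ?_⟩, fun x => ?_⟩
  · exact (totalDegree_bind₁_le_of_forall_le_one _ hφ _).trans (hdeg k).1
  · exact (totalDegree_bind₁_le_of_forall_le_one _ hφ _).trans (hdeg k).2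
  · simp only [eval_cube_bind₁_restrictVar]
    exact hval _

end PseudoBounded

/-- `1 - p ∈ K_T ↔ p ∈ K_T`. [folklore] -/
theorem pseudoBounded_one_sub_iff (T : ℕ) (p : MvPolynomial (Fin N) ℝ) :
    PseudoBounded T (1 - p) ↔ PseudoBounded T p := by
  refine ⟨fun h => ?_, PseudoBounded.one_sub⟩
  have h' := h.one_sub
  rwa [sub_sub_cancel] at h'

/-- Non-vacuity, order `0`: a constant `c ∈ [0,1]` is pseudo-bounded of every order
(`c = (√c)²`, `1 - c = (√(1-c))²`). [folklore] -/
theorem pseudoBounded_C {c : ℝ} (h0 : 0 ≤ c) (h1 : c ≤ 1) (T : ℕ) :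
    PseudoBounded T (C c : MvPolynomial (Fin N) ℝ) := by
  refine ⟨1, fun _ => C (Real.sqrt c), fun _ => C (Real.sqrt (1 - c)), fun _ => ⟨?_, ?_⟩,
    fun x => ⟨?_, ?_⟩⟩
  · rw [totalDegree_C]
    exact Nat.zero_le _
  · rw [totalDegree_C]
    exact Nat.zero_le _
  · simp [Real.sq_sqrt h0]
  · simp [Real.sq_sqrt (sub_nonneg.mpr h1)]

/-- Non-vacuity, order `1`: a single variable `Xᵢ` is pseudo-bounded of every order `T ≥ 1`
(`xᵢ = xᵢ²` and `1 - xᵢ = (1 - xᵢ)²` on the cube) — the acceptance probability of the one-query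
algorithm "query bit `i` and output it". [folklore] -/
theorem pseudoBounded_X (i : Fin N) {T : ℕ} (hT : 1 ≤ T) :
    PseudoBounded T (X i : MvPolynomial (Fin N) ℝ) := by
  refine ⟨1, fun _ => X i, fun _ => 1 - X i, fun _ => ⟨?_, ?_⟩, fun x => ?_⟩
  · rwa [totalDegree_X]
  · refine (totalDegree_sub _ _).trans (max_le ?_ ?_)
    · rw [totalDegree_one]
      exact Nat.zero_le _
    · rwa [totalDegree_X]
  · cases hx : x i <;> simp [hx]

/-- Non-triviality: a polynomial exceeding `1` somewhere on the cube is not pseudo-bounded of any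
order; e.g. the constant `2` (the cube is nonempty). [folklore] -/
theorem not_pseudoBounded_C_two (T : ℕ) : ¬ PseudoBounded T (C 2 : MvPolynomial (Fin N) ℝ) := by
  intro h
  have h1 := h.eval_le_one fun _ => false
  norm_num at h1

end Literature.Computability.QuantumComplexity
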